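import Summits.BirchSwinnertonDyer.BirchSwinnertonDyer.Theorems.ClassRecordThreeCornerTwistWitnessDefs
import Summits.BirchSwinnertonDyer.BirchSwinnertonDyer.Theorems.ErratumRoadFiveNonSurjCornerBranchesAn
import Summits.BirchSwinnertonDyer.BirchSwinnertonDyer.Theorems.ErratumRoadFiveNonSurjCornerTwinMuAnUnitValue
import Summits.BirchSwinnertonDyer.Rank1Residual.X11b.TwistTransportIrr
import Literature.NumberTheory.EllipticCurves.QuadraticTwistPadicReduction
import Literature.NumberTheory.EllipticCurves.MatsunoTwistedCurvesLocalProofs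
import Literature.NumberTheory.EllipticCurves.HeegnerHypothesisKroneckerProofs
import Literature.NumberTheory.EllipticCurves.BSDSelmerSkinnerThmBProofs
import HarnessLib

/-!
# Routes `ClassRecordThree` / `KolyvaginRoadThree` (rung K2@3), crux 7 `CornerAtThree` (item
# stmt-BirchSwinnertonDyer-19111) — the UNIT-TWIN ENGINE on t0: ONE odd Heegner twin whose Néron-normalised
# central value is a `3`-adic unit IS a twist witness `CornerTwistWitnessAt W` (crux idea F, kernel K3; cell
# `bsd-stepL`, seat `bsd-stepL-mult-p3` g4; `--supports stmt-BirchSwinnertonDyer-19111 --as helper`)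

Theorems only; no definition, no named fact, no `sorry`. NO new mathematics: every arrow is a landed tree theorem
or elementary bookkeeping; this file threads them at ONE supplied twin.

## The engine (card F «one-datum re-cut + unit/exact-twin supply», K3)

For a (T4″)@3 corner pair `(E,3)` (`(E,3) ∈` X11b, `ρ̄_{E,3}` not onto) on t0 (`3 ∤ ∏_ℓ c_ℓ(E)`) and an odd Heegner twin
`Wd = Cd • E^{(d_K)}` (`d_K` odd, `d_K < -4`, Heegner for `N_E` and for `3`, `L(E^{d_K},1) ≠ 0`) whose value
`q = L(Wd,1)/Ω(Wd)` is a non-zero rational `3`-ADIC UNIT: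

1. `Wd` is multiplicative at `3`, of analytic rank `0`, `Wd[3]` irreducible, `ρ̄_{Wd,3}` not onto (tree twist lemmas),
   and NON-SPLIT at `3`: `E` is non-split at `3` on t0 (`three_dvd_tamagawaProduct_of_corner_split`) and `d_K` is a
   square in `ℚ₃` (`3` split in `K`), so `Wd ≅ E` over `ℚ₃` (§1 `hasSplitMultiplicativeReductionAtPrime_twin_iff`);
2. for every newform `f` of `Wd` and period ratio `ϖ` (`ϖ·Ω(Wd) = Ω⁺_f`): `ϖ·[0]⁺_f = q` (§2, Mazur–Tate–Teitelbaum
   §I.8 `L(f,1) = [0]⁺_f·Ω⁺_f`), so the constant term `2·ϖ·[0]⁺_f` of `ϖ·L_3(f)` (`a = −1`, no exceptional zero) is a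
   `3`-adic unit: the ANALYTIC `μ = 0` certificate (`MuAnUnit.exists_norm_coeff_eq_one_of_neg_one_of_padicValRat_eq_zero`);
3. hence `X11b.MultDivisibilityAt Wd 3` from the corner lane's `μ`-transfer engine
   (`multDivisibilityAt_of_katoFacts_of_muAn`: Kato's rational divisibility ×6 facts, Greenberg 1999 Thm. 1.5, Wuthrich
   Cor. 18, F1-mult) and the Kato half `Typed.MissingUpperBoundAt Wd 3`
   (`missingUpperBoundAt_of_multDivisibilityAt_of_analyticRank_eq_zero`: Stein–Wuthrich ×2, GZK, modularity ×2,
   Greenberg–Stevens);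
4. the main-conjecture half `Typed.MissingLowerBoundAt Wd 3` is FREE: `#Ш_an(Wd) = q·#tors(Wd)²/∏c(Wd)` has
   `ord₃ = 0 + 0 − 0` (`Wd[3]` irreducible ⇒ `3 ∤ #tors`; `ord₃ ∏c(Wd) = ord₃ ∏c(E) = 0` by the Heegner transport) (§3);
5. so `BSDp Wd 3` (§4 `bsdp_twin_of_unit_value`), i.e. the twin IS a witness: §5
   **`cornerTwistWitnessAt_of_unitTwinSupply`** = `UnitTwinSupply-shape → 3 ∤ ∏c(E) → (13 named facts) →
   CornerTwistWitnessAt W` (the supply hypothesis is VERBATIM the body of the planner's sketch predicate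
   `UnitTwinSupplyAt W`, `Cruxes/CornerAtThree/IdeaOneDatumRecutUnitTwinSketch.lean` l. 51, stated INLINE — no def).

Also §4 `bsdp_twin_of_muAn_of_lower` — the pointwise form of the corner lane's
`X11b.cornerTwistAt_of_lowerTwists_of_katoFacts_of_muAn` (`…CornerAtThreeBranches.lean` §1) at ONE twin
(any Tamagawa exponent): certificate at `Wd` + lower half at `Wd` ⇒ `BSDp Wd 3` — the carrier case's receptacle.

HONEST FRAMING: CONDITIONAL on the thirteen named published facts displayed (Stein–Wuthrich 2013 Thm. 6.1 ×2, GZK,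
modularity ×2, Greenberg–Stevens, Kato 2004 (12.2.1) ∕ Thm. 12.4 ∕ §17.13 inputs ×3, Greenberg 1999 Thm. 1.5, Wuthrich
2014 Cor. 18) and on the SUPPLIED unit twin (crux F1 of card F — beyond print at `ℓ = 3 ∣ N`; per-pair certifiable:
CERT-TWISTMUAN-3, kit j266708, 8/8 twins exact); nothing booked; item 19111 does NOT close; no census word, tier or
label moves (T7); O2 stays OPEN; BSD(E,3) is proved for no class by this file.

References: [MazurTateTeitelbaum1986] §I.8 (8.6), §I.10, §I.14; [GreenbergLNM1716] §4 (`l_v = 2`), Thm. 1.5;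
[Kato2004Asterisque] Thm. 12.4–12.6, §17.13; [Wuthrich2014] Cor. 18; [SteinWuthrich2013] Thm. 6.1; [Miller2011LMS]
Def. 1.1; [SilvermanAEC2009] VII.5 Prop. 5.1, X.5 Cor. 5.4; [Serre1973] II §3.3 Thm. 3; [GrossKohnenZagier1987] (card F);
tree: `…CornerAtThreeBranches.lean` §1, `…NonSurjCornerBranchesAn.lean`, `…NonSurjCornerTwinMuAnUnitValue.lean`,
`…NonSurjCornerTwinKatoEngine.lean`; cell board RULING 33 + ADDENDUM (2026-08-27).
-/

set_option autoImplicit false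
-- the cell's Theorems namespace repeats the summit name (Summit.<Summit>.<Problem>), as in every sibling file
set_option linter.dupNamespace false

noncomputable section

open scoped Classical NumberField MatrixGroups ModularForm

namespace Summit.BirchSwinnertonDyer.BirchSwinnertonDyer.Theorems.CornerTwistWitness

open CongruenceSubgroup WeierstrassCurve NumberField IsDedekindDomain Field
  Literature.NumberTheory.EllipticCurves
  Literature.NumberTheory.EllipticCurves.ModularForms
  Literature.NumberTheory.EllipticCurves.Rank1Residual
  Literature.NumberTheory.EllipticCurves.Rank1Residual.Typed
  Literature.NumberTheory.EllipticCurves.Wuthrich2014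
  Literature.NumberTheory.EllipticCurves.SteinWuthrich2013
  Literature.NumberTheory.EllipticCurves.Greenberg1999
  Literature.NumberTheory.EllipticCurves.Kato2004
  Literature.NumberTheory.QuadraticFields.Quadratic
  Summit.BirchSwinnertonDyer.Rank1Residual
  Summit.BirchSwinnertonDyer.Rank1Residual.X11b
  Summit.BirchSwinnertonDyer.Rank1Residual.X11b.Three
  Summit.BirchSwinnertonDyer.Rank1Residual.X11b.MuAnUnit

/-! ### §1 A Heegner twin has the same reduction type at a split prime -/

/-- **At an odd prime `p` split in `K`, `E^{(d_K)}` is split multiplicative at `p` iff `E` is.** The Heegner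
hypothesis for `p` gives `(d_K/p) = 1` (`Literature.SatisfiesHeegnerHypothesis.jacobiSym_discr_eq_one`), so `d_K` is a
square in `ℚ_p` (Hensel; `padic_isSquare_of_jacobiSym_eq_one`) and `E^{(d_K)} ≅ E` over `ℚ_p`
(`hasSplitMultiplicativeReductionAtPrime_quadraticTwist_iff`); the reduction type does not depend on the model
(`hasSplitMultiplicativeReductionAtPrime_smul_iff`). [cite: SilvermanAEC2009, X.5 Cor. 5.4 and VII.5 Prop. 5.1(b)]
[cite: Serre1973, Ch. II §3.3 Thm 3] -/
theorem hasSplitMultiplicativeReductionAtPrime_twin_iff (W : WeierstrassCurve ℚ) [W.IsElliptic]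
    (p : ℕ) [Fact p.Prime] (hp2 : p ≠ 2) (K : Type) [Field K] [NumberField K] (hK : IsImaginaryQuadratic K)
    (hHp : SatisfiesHeegnerHypothesis p K) {Wd : WeierstrassCurve ℚ} (Cd : VariableChange ℚ)
    (hWd : Cd • W.quadraticTwist (NumberField.discr K : ℚ) = Wd) :
    Wd.HasSplitMultiplicativeReductionAtPrime p ↔ W.HasSplitMultiplicativeReductionAtPrime p := by
  have hD0 : (NumberField.discr K : ℚ) ≠ 0 := by exact_mod_cast NumberField.discr_ne_zero K
  haveI : (W.quadraticTwist (NumberField.discr K : ℚ)).IsElliptic := W.isElliptic_quadraticTwist hD0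
  have hJ : jacobiSym (NumberField.discr K) p = 1 :=
    Literature.SatisfiesHeegnerHypothesis.jacobiSym_discr_eq_one hK.1 hHp Fact.out (dvd_refl p) hp2
  have hsq : IsSquare (algebraMap ℚ ℚ_[p] (NumberField.discr K : ℚ)) := by
    rw [map_intCast]
    exact padic_isSquare_of_jacobiSym_eq_one hp2 hJ
  rw [← hWd, hasSplitMultiplicativeReductionAtPrime_smul_iff,
    hasSplitMultiplicativeReductionAtPrime_quadraticTwist_iff W hD0 hsq]

/-- **On t0 the odd Heegner twins of a corner pair are NON-split at `3`.** On the (T4″)@3 corner, split at `3` forces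
`3 ∣ ∏_ℓ c_ℓ(E)` (`three_dvd_tamagawaProduct_of_corner_split`: `c₃ = ord₃ Δ_min ≡ 0 (mod 3)`), so on t0 the curve is
non-split at `3`, and so is every twin by a field in which `3` splits (§1). [cite: SilvermanAEC2009, X.5 Cor. 5.4] -/
theorem not_split_twin_of_corner_of_not_dvd_tamagawaProduct [Fact (Nat.Prime 3)]
    (W : WeierstrassCurve ℚ) [W.IsElliptic] [W.IsGloballyMinimal] (hX : ClassX11b W 3) (hns : ¬ Surj W 3)
    (ht0 : ¬ 3 ∣ W.tamagawaProduct) (K : Type) [Field K] [NumberField K] (hK : IsImaginaryQuadratic K)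
    (hH3 : SatisfiesHeegnerHypothesis 3 K) {Wd : WeierstrassCurve ℚ} (Cd : VariableChange ℚ)
    (hWd : Cd • W.quadraticTwist (NumberField.discr K : ℚ) = Wd) :
    ¬ Wd.HasSplitMultiplicativeReductionAtPrime 3 := fun hs ↦
  ht0 (three_dvd_tamagawaProduct_of_corner_split W hX hns
    ((hasSplitMultiplicativeReductionAtPrime_twin_iff W 3 (by decide) K hK hH3 Cd hWd).mp hs))

/-! ### §2 The Néron-normalised value as `ϖ·[0]⁺_f` -/

/-- **`ϖ·[0]⁺_f = L(E,1)/Ω(E)`** for the newform `f` of `E` and a period ratio `ϖ·Ω(E) = Ω⁺_f`: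
`L(E,1) = [0]⁺_f·Ω⁺_f` (Mazur–Tate–Teitelbaum §I.8, tree `IsNewformOf.entireLFunction_one_eq`) and `Ω(E) > 0`.
Bookkeeping. [cite: MazurTateTeitelbaum1986Invent, §I.8 (8.6)] -/
theorem periodRatio_mul_ratPlusSymbol_zero_eq {V : WeierstrassCurve ℚ} [V.IsElliptic] {N : ℕ} [NeZero N]
    {f : CuspForm (Gamma0 N) 2} (hf : IsNewformOf V f) {ϖ : ℚ}
    (hϖ : (ϖ : ℝ) * V.realPeriodRat = plusPeriod f) {q : ℚ}
    (hq : V.entireLFunction 1 / (V.realPeriodRat : ℂ) = (q : ℂ)) : ϖ * ratPlusSymbol f 0 = q := by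
  have hΩ : (V.realPeriodRat : ℂ) ≠ 0 := by exact_mod_cast V.realPeriodRat_pos_holds.ne'
  have h1 : (q : ℂ) = (ϖ : ℂ) * (ratPlusSymbol f 0 : ℚ) := by
    rw [← hq, hf.entireLFunction_one_eq, ← hϖ, div_eq_iff hΩ]
    push_cast
    ring
  exact_mod_cast h1.symm

/-! ### §3 The main-conjecture half is free at a unit twin -/

/-- **At a rank-`0` curve with `p ∤ #tors`, `p ∤ ∏c` and unit value `L(1)/Ω` the lower half `ord_p #Ш_an ≤ ord_p #Ш` is
free**: `#Ш_an = (L(1)/Ω)·#tors²/∏c` (Miller Def. 1.1, `Reg = 1` in rank `0` by GZK `hGZK`) has `ord_p = 0`.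
Bookkeeping. [cite: Miller2011LMS, §1 and Def. 1.1 (arXiv:1010.2431 p. 3)] -/
theorem missingLowerBoundAt_of_unit_value (hGZK : rank_eq_analyticRank_of_analyticRank_le_one)
    (V : WeierstrassCurve ℚ) [V.IsElliptic] (p : ℕ) [Fact p.Prime] (hr : V.analyticRank = 0)
    (htors : padicValNat p V.torsionOrder = 0) (htam : padicValNat p V.tamagawaProduct = 0)
    {q : ℚ} (hq0 : q ≠ 0) (hq : V.entireLFunction 1 / (V.realPeriodRat : ℂ) = (q : ℂ))
    (hvq : padicValRat p q = 0) : Typed.MissingLowerBoundAt V p := by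
  obtain ⟨hrank, _⟩ := hGZK V (by omega)
  have hmw : V.mordellWeilRank = 0 := by omega
  have hΩ : (V.realPeriodRat : ℂ) ≠ 0 := by exact_mod_cast V.realPeriodRat_pos_holds.ne'
  have hc : (V.tamagawaProduct : ℂ) ≠ 0 := by exact_mod_cast V.tamagawaProduct_pos_holds.ne'
  have ht' : (V.torsionOrder : ℚ) ≠ 0 := by exact_mod_cast V.torsionOrder_pos_holds.ne'
  have hc' : (V.tamagawaProduct : ℚ) ≠ 0 := by exact_mod_cast V.tamagawaProduct_pos_holds.ne'
  have hL : V.leadingLCoeff = V.entireLFunction 1 := leadingLCoeff_eq_of_analyticRank_eq_zero V hr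
  have hL1 : V.entireLFunction 1 = (q : ℂ) * (V.realPeriodRat : ℂ) := by rw [← div_eq_iff hΩ, hq]
  refine ⟨q * (V.torsionOrder : ℚ) ^ 2 / (V.tamagawaProduct : ℚ), ?_, ?_⟩
  · rw [shaAn_def, hL, V.regulator_eq_one_of_rank_zero hmw, Complex.ofReal_one, mul_one, hL1]
    push_cast
    field_simp
  · rw [padicValRat.div (mul_ne_zero hq0 (pow_ne_zero 2 ht')) hc', padicValRat.mul hq0 (pow_ne_zero 2 ht'),
      padicValRat.pow (V.torsionOrder : ℚ), padicValRat.of_nat, padicValRat.of_nat, hvq, htors, htam]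
    push_cast
    simp

/-! ### §4 `BSD₃` of ONE odd Heegner twin: from the analytic certificate + lower half; from a unit value on t0 -/

/-- **`BSD(Wd,3)` at ONE odd Heegner twin of a corner pair from the ANALYTIC `μ = 0` certificate at `Wd` and the lower
half at `Wd`** — the pointwise form of the corner lane's `X11b.cornerTwistAt_of_lowerTwists_of_katoFacts_of_muAn`
(`Theorems/ClassRecordThreeCornerAtThreeBranches.lean` §1) at a SUPPLIED twin (any Tamagawa exponent). Facts:
Stein–Wuthrich Thm. 6.1 (`hJs`, `hJn`), GZK, modularity (`hmod`, `hpar`), Greenberg–Stevens, the six facts of the twin's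
rational Kato layer (`hne`, `h12`, `hns`, `hsp`, `h15`, `h18`) and F1 at `p ∥ N` (`hfine`). At the twin: multiplicative at
`3`, `r_an = 0`, `Wd[3]` irreducible, `ρ̄` not onto (twist lemmas), so `multDivisibilityAt_of_katoFacts_of_muAn` with the
certificate `hAn` gives `MultDivisibilityAt Wd 3`, then `missingUpperBoundAt_of_multDivisibilityAt_of_analyticRank_eq_zero`
and `Typed.missingPPartAt_of_lower_of_upper`. CONDITIONAL on `hlow`, `hAn`; nothing booked.
-- adapted from Summits/BirchSwinnertonDyer/BirchSwinnertonDyer/Theorems/ClassRecordThreeCornerAtThreeBranches.lean (§1)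
[cite: Kato2004Asterisque, Thm. 12.6 (p. 222) and §17.13 (pp. 279–280)] [cite: Wuthrich2014, Cor. 18 (p. 398)]
[cite: SteinWuthrich2013, Thm. 6.1 (p. 20)] [cite: SilvermanAEC2009, X.5 Cor. 5.4] [cite: Miller2011LMS, §1 and Def. 1.1] -/
theorem bsdp_twin_of_muAn_of_lower
    (hJs : thm61_splitMultiplicative) (hJn : thm61_nonsplitMultiplicative)
    (hGZK : rank_eq_analyticRank_of_analyticRank_le_one) (hmod : hasEntireLFunction_rat)
    (hpar : nonempty_modularParametrizationData)
    (hGS : ∀ (W : WeierstrassCurve ℚ) [W.IsElliptic] [W.IsGloballyMinimal] (p : ℕ) [Fact p.Prime],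
      greenberg_stevens (W := W) (p := p))
    (hne : Kato2004.nonempty_iwasawaH1Data) (h12 : Kato2004.thm12_4)
    (hns : Kato2004.exists_multDivisibilityInputs_nonsplit)
    (hsp : Kato2004.exists_multDivisibilityInputs_split)
    (h15 : thm15_isTorsion_multiplicative_rat)
    (h18 : Wuthrich2014.corollary18_padicLFunction_mem_iwasawaAlgebra_multiplicative)
    (hfine : Kato2004.exists_multDivisibilityInputs_fine)
    (W : WeierstrassCurve ℚ) [W.IsElliptic] [W.IsGloballyMinimal] (hX : ClassX11b W 3) (hnsj : ¬ Surj W 3)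
    (K : Type) [Field K] [NumberField K] (Wd : WeierstrassCurve ℚ) [Wd.IsElliptic] [Wd.IsGloballyMinimal]
    (Cd : VariableChange ℚ) (hKq : IsImaginaryQuadratic K)
    (hHN : SatisfiesHeegnerHypothesis (W.conductorNorm ℤ) K)
    (hLt : (W.quadraticTwist (NumberField.discr K : ℚ)).entireLFunction 1 ≠ 0)
    (hWd : Cd • W.quadraticTwist (NumberField.discr K : ℚ) = Wd)
    -- the main-conjecture half at the twin
    (hlow : Typed.MissingLowerBoundAt Wd 3)
    -- the ANALYTIC `μ = 0` certificate at the twin (both signs allowed)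
    (hAn : ∀ {N : ℕ} [NeZero N] (f : CuspForm (Gamma0 N) 2), IsNewformOf Wd f →
      ∀ (ϖ : ℚ), (ϖ : ℝ) * Wd.realPeriodRat = plusPeriod f →
      ∀ (a : ℚ_[3]) (L : PowerSeries ℚ_[3]),
        (Wd.HasSplitMultiplicativeReductionAtPrime 3 → a = 1) →
        (¬ Wd.HasSplitMultiplicativeReductionAtPrime 3 → a = -1) →
        IsMultPAdicLFunctionOf f 3 a L →
        ∃ n : ℕ, ‖PowerSeries.coeff n (PowerSeries.C ((ϖ : ℚ) : ℚ_[3]) * L)‖ = 1) :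
    BSDp Wd 3 := by
  have hD0 : (NumberField.discr K : ℚ) ≠ 0 := by exact_mod_cast NumberField.discr_ne_zero K
  haveI hEt : (W.quadraticTwist (NumberField.discr K : ℚ)).IsElliptic := W.isElliptic_quadraticTwist hD0
  have hmultd : Wd.HasMultiplicativeReductionAtPrime 3 :=
    hasMultiplicativeReductionAtPrime_twist_of_heegner' W 3 K hKq hHN hX.2.2.1 Cd hWd
  have hLt' : (W.quadraticTwist (NumberField.discr K : ℚ)).entireLFunction = Wd.entireLFunction := by
    rw [← hWd, entireLFunction_smul]
  have hLd1 : Wd.entireLFunction 1 ≠ 0 := by rw [← hLt']; exact hLt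
  have hrd : Wd.analyticRank = 0 := (Wd.analyticRank_eq_zero_iff_holds (hmod Wd)).2 hLd1
  have hirrd : Wd.HasIrreducibleModPGaloisRep 3 :=
    hasIrreducibleModPGaloisRep_twist_model W 3 K hKq.1 hX.2.2.2 Cd hWd
  have hnsd : ¬ Surj Wd 3 := not_surj_twist_model W 3 hD0 hnsj Cd hWd
  have hdiv : MultDivisibilityAt Wd 3 :=
    multDivisibilityAt_of_katoFacts_of_muAn hne h12 hns hsp h15 h18 hfine Wd 3 (by decide) hmultd hirrd hnsd
      (fun f hf ϖ hϖ a L hsa hna hL ↦ hAn f hf ϖ hϖ a L hsa hna hL)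
  have hup : Typed.MissingUpperBoundAt Wd 3 :=
    missingUpperBoundAt_of_multDivisibilityAt_of_analyticRank_eq_zero hJs hJn hGZK hmod hpar Wd 3 (hGS Wd 3)
      (by decide) hmultd hrd hdiv
  exact Typed.bsdp_of_missingPPartAt Wd 3 hGZK (by rw [hrd]; exact zero_le_one)
    (Typed.missingPPartAt_of_lower_of_upper Wd 3 hlow hup)

/-- **`BSD(Wd,3)` at ONE odd Heegner twin ON t0 FROM A UNIT VALUE** — for a corner pair `(E,3)` with `3 ∤ ∏_ℓ c_ℓ(E)`
and an odd Heegner twin `Wd = Cd • E^{(d_K)}` (`3` split in `K`) with `L(Wd,1)/Ω(Wd) = q` a non-zero rational `3`-adic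
unit: the twin is NON-split at `3` (§1), the certificate is its constant term `2·ϖ·[0]⁺_f = 2q` (§2 +
`MuAnUnit.exists_norm_coeff_eq_one_of_neg_one_of_padicValRat_eq_zero`), the lower half is free (§3 with `3 ∤ #tors(Wd)`
by irreducibility and `ord₃ ∏c(Wd) = ord₃ ∏c(E) = 0` by the Heegner transport), and §4's first theorem concludes.
CONDITIONAL on the thirteen named facts; nothing booked. [cite: MazurTateTeitelbaum1986, §I.10 and §I.14]
[cite: GreenbergLNM1716, §4 (PDF p. 113)] [cite: Kato2004Asterisque, §17.13 (pp. 279–280)]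
[cite: Wuthrich2014, Cor. 18 (p. 398)] [cite: SteinWuthrich2013, Thm. 6.1 (p. 20)] [cite: Miller2011LMS, Def. 1.1] -/
theorem bsdp_twin_of_unit_value
    (hJs : thm61_splitMultiplicative) (hJn : thm61_nonsplitMultiplicative)
    (hGZK : rank_eq_analyticRank_of_analyticRank_le_one) (hmod : hasEntireLFunction_rat)
    (hpar : nonempty_modularParametrizationData)
    (hGS : ∀ (W : WeierstrassCurve ℚ) [W.IsElliptic] [W.IsGloballyMinimal] (p : ℕ) [Fact p.Prime],
      greenberg_stevens (W := W) (p := p))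
    (hne : Kato2004.nonempty_iwasawaH1Data) (h12 : Kato2004.thm12_4)
    (hns : Kato2004.exists_multDivisibilityInputs_nonsplit)
    (hsp : Kato2004.exists_multDivisibilityInputs_split)
    (h15 : thm15_isTorsion_multiplicative_rat)
    (h18 : Wuthrich2014.corollary18_padicLFunction_mem_iwasawaAlgebra_multiplicative)
    (hfine : Kato2004.exists_multDivisibilityInputs_fine)
    (W : WeierstrassCurve ℚ) [W.IsElliptic] [W.IsGloballyMinimal] (hX : ClassX11b W 3) (hnsj : ¬ Surj W 3)
    (ht0 : ¬ 3 ∣ W.tamagawaProduct)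
    (K : Type) [Field K] [NumberField K] (Wd : WeierstrassCurve ℚ) [Wd.IsElliptic] [Wd.IsGloballyMinimal]
    (Cd : VariableChange ℚ) (hKq : IsImaginaryQuadratic K) (hodd : Odd (NumberField.discr K))
    (hHN : SatisfiesHeegnerHypothesis (W.conductorNorm ℤ) K) (hH3 : SatisfiesHeegnerHypothesis 3 K)
    (hLt : (W.quadraticTwist (NumberField.discr K : ℚ)).entireLFunction 1 ≠ 0)
    (hWd : Cd • W.quadraticTwist (NumberField.discr K : ℚ) = Wd)
    {q : ℚ} (hq0 : q ≠ 0) (hq : Wd.entireLFunction 1 / (Wd.realPeriodRat : ℂ) = (q : ℂ))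
    (hvq : padicValRat 3 q = 0) : BSDp Wd 3 := by
  haveI : Fact (Nat.Prime 3) := ⟨Nat.prime_three⟩
  have hD0 : (NumberField.discr K : ℚ) ≠ 0 := by exact_mod_cast NumberField.discr_ne_zero K
  haveI hEt : (W.quadraticTwist (NumberField.discr K : ℚ)).IsElliptic := W.isElliptic_quadraticTwist hD0
  have hp2 : (3 : ℕ) ≠ 2 := by decide
  have hLt' : (W.quadraticTwist (NumberField.discr K : ℚ)).entireLFunction = Wd.entireLFunction := by
    rw [← hWd, entireLFunction_smul]
  have hLd1 : Wd.entireLFunction 1 ≠ 0 := by rw [← hLt']; exact hLt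
  have hrd : Wd.analyticRank = 0 := (Wd.analyticRank_eq_zero_iff_holds (hmod Wd)).2 hLd1
  have hirrd : Wd.HasIrreducibleModPGaloisRep 3 :=
    hasIrreducibleModPGaloisRep_twist_model W 3 K hKq.1 hX.2.2.2 Cd hWd
  have hWdns : ¬ Wd.HasSplitMultiplicativeReductionAtPrime 3 :=
    not_split_twin_of_corner_of_not_dvd_tamagawaProduct W hX hnsj ht0 K hKq hH3 Cd hWd
  -- lower half: free at a unit twin
  have hpd : ¬ (3 : ℤ) ∣ NumberField.discr K := not_dvd_discr_of_split hKq Nat.prime_three hp2 hH3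
  have htam : padicValNat 3 Wd.tamagawaProduct = 0 := by
    rw [X2.padicValNat_tamagawaProduct_twist_of_heegner_of_odd W 3 hp2 K hKq hodd hpd hHN Cd hWd]
    exact padicValNat.eq_zero_of_not_dvd ht0
  have hlow : Typed.MissingLowerBoundAt Wd 3 :=
    missingLowerBoundAt_of_unit_value hGZK Wd 3 hrd (padicValNat_torsionOrder_eq_zero_of_irreducible Wd 3 hirrd) htam
      hq0 hq hvq
  -- upper half: the unit value IS the analytic certificate (non-split at `3`, constant term)
  refine bsdp_twin_of_muAn_of_lower hJs hJn hGZK hmod hpar hGS hne h12 hns hsp h15 h18 hfine W hX hnsj K Wd Cd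
    hKq hHN hLt hWd hlow ?_
  intro N _ f hf ϖ hϖ a L _hsa hna hL
  have ha : a = -1 := hna hWdns
  subst ha
  have hϖq : ϖ * ratPlusSymbol f 0 = q := periodRatio_mul_ratPlusSymbol_zero_eq hf hϖ hq
  exact exists_norm_coeff_eq_one_of_neg_one_of_padicValRat_eq_zero hp2 hL ϖ (by rw [hϖq]; exact hq0)
    (by rw [hϖq]; exact hvq)

/-! ### §5 The engine: a unit odd Heegner twin IS a twist witness on t0 -/

/-- **THE UNIT-TWIN ENGINE (card F, K3): on t0 a UNIT-VALUE odd Heegner twin IS a `CornerTwistWitnessAt` witness.**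
Hypothesis `hunit` is VERBATIM the body of the planner's sketch predicate `UnitTwinSupplyAt W`
(`Cruxes/CornerAtThree/IdeaOneDatumRecutUnitTwinSketch.lean` l. 51, stated INLINE): for `(E,3) ∈` X11b, `ρ̄_{E,3}` not
onto, `3 ∤ ∏c(E)` — SOME imaginary quadratic `K` (`d_K` odd, `d_K < -4`, Heegner for `N_E` and `3`, `L(E^{d_K},1) ≠ 0`)
and a global minimal twist model `Wd` with `L(Wd,1)/Ω(Wd)` a non-zero rational `3`-adic unit. Conclusion:
`CornerTwistWitnessAt W` (the ∃-recut of (Tw), `Theorems/ClassRecordThreeCornerTwistWitnessDefs.lean`) — by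
`bsdp_twin_of_unit_value` at that twin. CONDITIONAL on the thirteen named facts and on the supplied unit twin (crux F1;
per-pair certifiable); nothing booked; item 19111 does NOT close.
[cite: MazurTateTeitelbaum1986, §I.10] [cite: Kato2004Asterisque, §17.13 (pp. 279–280)] [cite: Wuthrich2014, Cor. 18 (p. 398)]
[cite: SteinWuthrich2013, Thm. 6.1 (p. 20)] [cite: GreenbergLNM1716, Thm. 1.5 (PDF p. 61)] [cite: Miller2011LMS, Def. 1.1] -/
theorem cornerTwistWitnessAt_of_unitTwinSupply
    (hJs : thm61_splitMultiplicative) (hJn : thm61_nonsplitMultiplicative)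
    (hGZK : rank_eq_analyticRank_of_analyticRank_le_one) (hmod : hasEntireLFunction_rat)
    (hpar : nonempty_modularParametrizationData)
    (hGS : ∀ (W : WeierstrassCurve ℚ) [W.IsElliptic] [W.IsGloballyMinimal] (p : ℕ) [Fact p.Prime],
      greenberg_stevens (W := W) (p := p))
    (hne : Kato2004.nonempty_iwasawaH1Data) (h12 : Kato2004.thm12_4)
    (hns : Kato2004.exists_multDivisibilityInputs_nonsplit)
    (hsp : Kato2004.exists_multDivisibilityInputs_split)
    (h15 : thm15_isTorsion_multiplicative_rat)
    (h18 : Wuthrich2014.corollary18_padicLFunction_mem_iwasawaAlgebra_multiplicative)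
    (hfine : Kato2004.exists_multDivisibilityInputs_fine)
    (W : WeierstrassCurve ℚ) [W.IsElliptic] [W.IsGloballyMinimal]
    -- F1 on t0 (unit-twin supply, the body of `UnitTwinSupplyAt W` verbatim)
    (hunit : ClassX11b W 3 → ¬ Surj W 3 → ¬ 3 ∣ W.tamagawaProduct →
      ∃ (K : Type) (_ : Field K) (_ : NumberField K)
        (Wd : WeierstrassCurve ℚ) (_ : Wd.IsElliptic) (_ : Wd.IsGloballyMinimal) (Cd : VariableChange ℚ),
        IsImaginaryQuadratic K ∧ Odd (NumberField.discr K) ∧ NumberField.discr K < -4 ∧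
          SatisfiesHeegnerHypothesis (W.conductorNorm ℤ) K ∧ SatisfiesHeegnerHypothesis 3 K ∧
          (W.quadraticTwist (NumberField.discr K : ℚ)).entireLFunction 1 ≠ 0 ∧
          Cd • W.quadraticTwist (NumberField.discr K : ℚ) = Wd ∧
          ∃ q : ℚ, q ≠ 0 ∧ Wd.entireLFunction 1 / (Wd.realPeriodRat : ℂ) = (q : ℂ) ∧ padicValRat 3 q = 0)
    (ht0 : ¬ 3 ∣ W.tamagawaProduct) : CornerTwistWitnessAt W := by
  intro hX hnsj
  obtain ⟨K, _, _, Wd, _, _, Cd, hKq, hodd, hlt, hHN, hH3, hLt, hWd, q, hq0, hq, hvq⟩ := hunit hX hnsj ht0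
  exact ⟨K, inferInstance, inferInstance, Wd, inferInstance, inferInstance, Cd, hKq, hodd, hlt, hHN, hH3, hLt, hWd,
    bsdp_twin_of_unit_value hJs hJn hGZK hmod hpar hGS hne h12 hns hsp h15 h18 hfine W hX hnsj ht0 K Wd Cd hKq
      hodd hHN hH3 hLt hWd hq0 hq hvq⟩

end Summit.BirchSwinnertonDyer.BirchSwinnertonDyer.Theorems.CornerTwistWitness

end
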